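import Summits.CriticalPhenomena.Ising3D.Control2DPolyCert
import Mathlib.Tactic.Linarith
import Mathlib.Tactic.Positivity
import Mathlib.Tactic.Ring
import Mathlib.Tactic.FieldSimp
import HarnessLib

/-!
# Bivariate integer coefficient lists and a tensor-Bernstein positivity certificate
(cell `pub-ising3x`, seat controls-1 gen 16; KERNEL PATH for the 2D γ (derivative-functional)
certificates, step 4a — the kernel's exact bivariate polynomial arithmetic — CONTROL-ONLY scaffolding)

HONEST FRAMING: lottery ticket; floor = tightest certified 3D Ising CFT bounds; no exact-solution
claim without a proof. Nothing numerical about any CFT is asserted here.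

The REGION obligation (R) of a 2D γ-certificate at `z = z̄ = 1/2` is the non-negativity of ONE bivariate
polynomial `R(b, x)` (`x = b + J`) on `b ≥ 0`, `J ∈ ℕ`, `2b + J ≥ E₀`. For the `Λ = 7` tables the
coefficient signs settled it (`Control2DGammaL7Table`); from `Λ = 11` on they do not (reader B of record
certifies (R) by tensor-Bernstein boxes in `(S, w)` plus an integer-`j` discharge). This file is the
bivariate twin of `Control2DPolyCert`, the exact-integer layer the kernel evaluates by `decide`:
* `evalR₂ P x y = Σ_i row_i(y) x^i` for `P : List (List ℤ)` (outer variable `x`, rows = integer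
  coefficient lists in `y`), with computable `zadd₂`, `zsmul₂`, `zouter p q = p(x) q(y)` and their
  evaluation homomorphisms;
* `zaffI n q a L` (inner affine substitution `y = (a + L u)/q` on rows padded to length `n`) and
  `zaffO q a L` (outer substitution `x = (a + L t)/q`, Horner) — all integer;
* `zbernO cs = Σ_j (1-X)^{m-j} X^j ⊗ zbern cs_j`, non-negative on `[0,1]²` when all entries of `cs` are `≥ 0`;
* `bernCheck₂ P n q₁ a₁ L₁ q₂ a₂ L₂ cs` (row lengths `≤ n`, all `cs ≥ 0`, and the transformed polynomial
  IS the tensor-Bernstein form `zbernO cs`, decidable) and its soundness `evalR₂_nonneg_of_bernCheck₂`: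
  then `P(x, y) ≥ 0` on `[a₁/q₁, (a₁+L₁)/q₁] × [a₂/q₂, (a₂+L₂)/q₂]`.
The certificate `cs` (unnormalised tensor-Bernstein coefficients) is produced outside (exact mirror
HOME/code/controls/kp3/kmirror2.py) and only CHECKED here. Elementary; no facts.
References: [folklore] (tensor-product Bernstein basis); `Control2DPolyCert` (univariate layer).
-/

namespace Summit.CriticalPhenomena.Ising3D.Control2D

open Literature.Analysis.ValidatedNumerics.PolyMP

/-! ### Bivariate integer coefficient lists -/

/-- `P(x, y) = Σ_i row_i(y) · x^i` (outer variable `x`; each row an integer coefficient list in `y`).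
[folklore] -/
noncomputable def evalR₂ : List (List ℤ) → ℝ → ℝ → ℝ
  | [], _, _ => 0
  | r :: rs, x, y => evalR (castZ r) y + x * evalR₂ rs x y

/-- [folklore] -/
@[simp] theorem evalR₂_nil (x y : ℝ) : evalR₂ [] x y = 0 := rfl

/-- [folklore] -/
@[simp] theorem evalR₂_cons (r : List ℤ) (rs : List (List ℤ)) (x y : ℝ) :
    evalR₂ (r :: rs) x y = evalR (castZ r) y + x * evalR₂ rs x y := rfl

/-- Coefficientwise (rowwise) sum. [folklore] -/
def zadd₂ : List (List ℤ) → List (List ℤ) → List (List ℤ)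
  | [], Q => Q
  | r :: rs, [] => r :: rs
  | r :: rs, s :: ss => zadd r s :: zadd₂ rs ss

/-- [folklore] -/
theorem evalR₂_zadd₂ : ∀ (P Q : List (List ℤ)) (x y : ℝ),
    evalR₂ (zadd₂ P Q) x y = evalR₂ P x y + evalR₂ Q x y
  | [], Q, x, y => by simp [zadd₂]
  | r :: rs, [], x, y => by simp [zadd₂]
  | r :: rs, s :: ss, x, y => by
      simp only [zadd₂, evalR₂_cons, evalR_zadd, evalR₂_zadd₂ rs ss x y]; ring

/-- Integer scalar multiple. [folklore] -/
def zsmul₂ (c : ℤ) : List (List ℤ) → List (List ℤ)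
  | [] => []
  | r :: rs => zsmul c r :: zsmul₂ c rs

/-- [folklore] -/
theorem evalR₂_zsmul₂ (c : ℤ) : ∀ (P : List (List ℤ)) (x y : ℝ),
    evalR₂ (zsmul₂ c P) x y = (c : ℝ) * evalR₂ P x y
  | [], x, y => by simp [zsmul₂]
  | r :: rs, x, y => by
      simp only [zsmul₂, evalR₂_cons, evalR_zsmul, evalR₂_zsmul₂ c rs x y]; ring

/-- Outer product `p(x) · q(y)`. [folklore] -/
def zouter : List ℤ → List ℤ → List (List ℤ)
  | [], _ => []
  | c :: cs, q => zsmul c q :: zouter cs q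

/-- [folklore] -/
theorem evalR₂_zouter : ∀ (p q : List ℤ) (x y : ℝ),
    evalR₂ (zouter p q) x y = evalR (castZ p) x * evalR (castZ q) y
  | [], q, x, y => by simp [zouter]
  | c :: cs, q, x, y => by
      simp only [zouter, evalR₂_cons, evalR_zsmul, castZ_cons, evalR_cons, evalR₂_zouter cs q x y]
      ring

/-! ### Padding and the inner / outer affine substitutions (all integer) -/

/-- Pad a row with zeros to length `n` (no-op on the value). [folklore] -/
def zpad (n : ℕ) (r : List ℤ) : List ℤ := r ++ List.replicate (n - r.length) 0

/-- [folklore] -/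
theorem evalR_castZ_append_zeros (y : ℝ) : ∀ (r : List ℤ) (m : ℕ),
    evalR (castZ (r ++ List.replicate m 0)) y = evalR (castZ r) y
  | [], 0 => by simp
  | [], m + 1 => by
      have h := evalR_castZ_append_zeros y [] m
      simp only [List.nil_append] at h
      simp only [List.nil_append, List.replicate_succ, castZ_cons, evalR_cons, Int.cast_zero, h,
        castZ_nil, evalR_nil, mul_zero, add_zero]
  | a :: as, m => by
      simp only [List.cons_append, castZ_cons, evalR_cons, evalR_castZ_append_zeros y as m]

/-- [folklore] -/
theorem evalR_zpad (n : ℕ) (r : List ℤ) (y : ℝ) : evalR (castZ (zpad n r)) y = evalR (castZ r) y :=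
  evalR_castZ_append_zeros y r _

/-- [folklore] -/
theorem length_zpad {n : ℕ} {r : List ℤ} (h : r.length ≤ n) : (zpad n r).length = n := by
  simp only [zpad, List.length_append, List.length_replicate]; omega

/-- Inner substitution `y = (a + L u)/q` on every row padded to length `n`:
row `↦ zaff q a L (zpad n row)` (`= q^{n-1} · row((a + L u)/q)` as a list in `u`). [folklore] -/
def zaffI (n : ℕ) (q a L : ℤ) : List (List ℤ) → List (List ℤ)
  | [] => []
  | r :: rs => zaff q a L (zpad n r) :: zaffI n q a L rs

/-- [folklore] -/
theorem length_zaffI (n : ℕ) (q a L : ℤ) : ∀ P : List (List ℤ), (zaffI n q a L P).length = P.length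
  | [] => rfl
  | r :: rs => by simp only [zaffI, List.length_cons, length_zaffI n q a L rs]

/-- **`zaffI` evaluates to `q^{n-1} · P(x, (a + L u)/q)`** when every row has length `≤ n`
(`q ≠ 0`). [folklore] -/
theorem evalR₂_zaffI {q : ℤ} (hq : (q : ℝ) ≠ 0) (n : ℕ) (a L : ℤ) (x u : ℝ) :
    ∀ P : List (List ℤ), (∀ r ∈ P, r.length ≤ n) →
      evalR₂ (zaffI n q a L P) x u = (q : ℝ) ^ (n - 1) * evalR₂ P x (((a : ℝ) + L * u) / q)
  | [], _ => by simp [zaffI]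
  | r :: rs, h => by
      have hr : r.length ≤ n := h r (by simp)
      have ih := evalR₂_zaffI hq n a L x u rs fun r' hr' => h r' (by simp [hr'])
      rw [zaffI, evalR₂_cons, evalR₂_cons, evalR_zaff hq, length_zpad hr, evalR_zpad, ih]
      ring

/-- `(a + L X) · R` in the outer variable. [folklore] -/
def zlinO (a L : ℤ) (R : List (List ℤ)) : List (List ℤ) :=
  zadd₂ (zsmul₂ a R) ([] :: zsmul₂ L R)

/-- [folklore] -/
theorem evalR₂_zlinO (a L : ℤ) (R : List (List ℤ)) (t y : ℝ) :
    evalR₂ (zlinO a L R) t y = ((a : ℝ) + L * t) * evalR₂ R t y := by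
  simp only [zlinO, evalR₂_zadd₂, evalR₂_zsmul₂, evalR₂_cons, castZ_nil, evalR_nil]; ring

/-- Horner form of `q^{|P|-1} · P((a + L t)/q, y)` (outer substitution), all integer. [folklore] -/
def zaffO (q a L : ℤ) : List (List ℤ) → List (List ℤ)
  | [] => []
  | r :: rs => zadd₂ [zsmul (q ^ rs.length) r] (zlinO a L (zaffO q a L rs))

/-- **`zaffO` evaluates to `q^{|P|-1} P((a + L t)/q, y)`** (`q ≠ 0`). [folklore] -/
theorem evalR₂_zaffO {q : ℤ} (hq : (q : ℝ) ≠ 0) (a L : ℤ) (t y : ℝ) : ∀ P : List (List ℤ),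
    evalR₂ (zaffO q a L P) t y =
      (q : ℝ) ^ (P.length - 1) * evalR₂ P (((a : ℝ) + L * t) / q) y
  | [] => by simp [zaffO]
  | [r] => by
      simp only [zaffO, List.length_nil, pow_zero, zlinO, zsmul₂, zadd₂, evalR₂_cons, evalR₂_nil,
        evalR_zadd, evalR_zsmul, castZ_nil, evalR_nil, List.length_singleton, Nat.sub_self,
        Int.cast_one]
      ring
  | r :: r' :: rs => by
      have ih := evalR₂_zaffO hq a L t y (r' :: rs)
      rw [zaffO, evalR₂_zadd₂, evalR₂_zlinO, ih]
      simp only [evalR₂_cons, evalR₂_nil, evalR_zsmul, List.length_cons, Nat.add_sub_cancel,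
        pow_succ, mul_zero, add_zero]
      push_cast
      field_simp

/-! ### The tensor-Bernstein form -/

/-- `Σ_j X^j (1-X)^{m-j} ⊗ zbern cs_j` with `m + 1 = |cs|`. [folklore] -/
def zbernO : List (List ℤ) → List (List ℤ)
  | [] => []
  | r :: rs => zadd₂ (zouter (zOneSub rs.length) (zbern r)) ([] :: zbernO rs)

/-- **The tensor-Bernstein form of a non-negative table is non-negative on `[0,1]²`.** [folklore] -/
theorem evalR₂_zbernO_nonneg {x y : ℝ} (hx0 : 0 ≤ x) (hx1 : x ≤ 1) (hy0 : 0 ≤ y) (hy1 : y ≤ 1) :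
    ∀ cs : List (List ℤ), (∀ r ∈ cs, ∀ c ∈ r, (0 : ℤ) ≤ c) → 0 ≤ evalR₂ (zbernO cs) x y
  | [], _ => by simp [zbernO]
  | r :: rs, h => by
      rw [zbernO, evalR₂_zadd₂, evalR₂_zouter, evalR_zOneSub, evalR₂_cons]
      simp only [castZ_nil, evalR_nil, zero_add]
      have h1 := evalR_zbern_nonneg hy0 hy1 r (h r (by simp))
      have ih := evalR₂_zbernO_nonneg hx0 hx1 hy0 hy1 rs fun r' hr' => h r' (by simp [hr'])
      have h2 : (0 : ℝ) ≤ 1 - x := by linarith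
      positivity

/-! ### The certificate check and its soundness -/

/-- A unit parameter for a point of `[a/q, (a+L)/q]` (`q > 0`, `L ≥ 0`). [folklore] -/
theorem exists_unitParam {q a L : ℤ} (hq : 0 < q) (hL : 0 ≤ L) {x : ℝ} (hlo : (a : ℝ) / q ≤ x)
    (hhi : x ≤ ((a : ℝ) + L) / q) :
    ∃ t : ℝ, 0 ≤ t ∧ t ≤ 1 ∧ ((a : ℝ) + L * t) / q = x := by
  have hqR : (0 : ℝ) < q := by exact_mod_cast hq
  have hLR : (0 : ℝ) ≤ L := by exact_mod_cast hL
  have hqx1 : (a : ℝ) ≤ q * x := by rwa [div_le_iff₀ hqR, mul_comm] at hlo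
  have hqx2 : (q : ℝ) * x ≤ a + L := by rwa [le_div_iff₀ hqR, mul_comm] at hhi
  rcases hLR.lt_or_eq with hLpos | hL0
  · refine ⟨((q : ℝ) * x - a) / L, div_nonneg (by linarith) hLpos.le, ?_, ?_⟩
    · rw [div_le_one hLpos]; linarith
    · field_simp; ring
  · refine ⟨0, le_rfl, zero_le_one, ?_⟩
    rw [← hL0, add_zero] at hqx2
    rw [← hL0, mul_zero, add_zero]
    have : (a : ℝ) = q * x := le_antisymm hqx1 hqx2
    rw [this]; field_simp

/-- **Tensor-Bernstein certificate check** for `P ≥ 0` on `[a₁/q₁, (a₁+L₁)/q₁] × [a₂/q₂, (a₂+L₂)/q₂]`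
(outer variable first): every row of `P` has length `≤ n`, all supplied coefficients `cs` are `≥ 0`, and the
transformed polynomial `zaffO q₁ a₁ L₁ (zaffI n q₂ a₂ L₂ P)` is literally the tensor-Bernstein form
`zbernO cs`. Decidable by `decide` (exact integer arithmetic). [folklore] -/
def bernCheck₂ (P : List (List ℤ)) (n : ℕ) (q₁ a₁ L₁ q₂ a₂ L₂ : ℤ) (cs : List (List ℤ)) : Bool :=
  P.all (fun r => decide (r.length ≤ n)) &&
    (cs.all (fun r => r.all fun c => decide (0 ≤ c)) &&
      decide (zaffO q₁ a₁ L₁ (zaffI n q₂ a₂ L₂ P) = zbernO cs))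

/-- **Soundness of the tensor-Bernstein certificate**: `bernCheck₂ P n q₁ a₁ L₁ q₂ a₂ L₂ cs = true` with
`q₁, q₂ > 0`, `L₁, L₂ ≥ 0` gives `P(x, y) ≥ 0` for `a₁/q₁ ≤ x ≤ (a₁+L₁)/q₁`, `a₂/q₂ ≤ y ≤ (a₂+L₂)/q₂`.
PROVED (`x = (a₁ + L₁ t)/q₁`, `y = (a₂ + L₂ u)/q₂` with `t, u ∈ [0,1]`; then
`q₁^{|P|-1} q₂^{n-1} P(x, y) = zbernO cs (t, u) ≥ 0`). [folklore] -/
theorem evalR₂_nonneg_of_bernCheck₂ {P cs : List (List ℤ)} {n : ℕ} {q₁ a₁ L₁ q₂ a₂ L₂ : ℤ}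
    (hq₁ : 0 < q₁) (hq₂ : 0 < q₂) (hL₁ : 0 ≤ L₁) (hL₂ : 0 ≤ L₂)
    (h : bernCheck₂ P n q₁ a₁ L₁ q₂ a₂ L₂ cs = true) {x y : ℝ}
    (hx1 : (a₁ : ℝ) / q₁ ≤ x) (hx2 : x ≤ ((a₁ : ℝ) + L₁) / q₁)
    (hy1 : (a₂ : ℝ) / q₂ ≤ y) (hy2 : y ≤ ((a₂ : ℝ) + L₂) / q₂) : 0 ≤ evalR₂ P x y := by
  simp only [bernCheck₂, Bool.and_eq_true, List.all_eq_true, decide_eq_true_eq] at h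
  obtain ⟨hlen, hall, heq⟩ := h
  have hq₁R : (0 : ℝ) < q₁ := by exact_mod_cast hq₁
  have hq₂R : (0 : ℝ) < q₂ := by exact_mod_cast hq₂
  obtain ⟨t, ht0, ht1, ht⟩ := exists_unitParam hq₁ hL₁ hx1 hx2
  obtain ⟨u, hu0, hu1, hu⟩ := exists_unitParam hq₂ hL₂ hy1 hy2
  have key := evalR₂_zaffO hq₁R.ne' a₁ L₁ t u (zaffI n q₂ a₂ L₂ P)
  rw [length_zaffI, ht, evalR₂_zaffI hq₂R.ne' n a₂ L₂ x u P hlen, hu, heq] at key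
  have hB := evalR₂_zbernO_nonneg ht0 ht1 hu0 hu1 cs hall
  rw [key, ← mul_assoc] at hB
  have hpos : (0 : ℝ) < (q₁ : ℝ) ^ (P.length - 1) * (q₂ : ℝ) ^ (n - 1) := by positivity
  exact (mul_nonneg_iff_of_pos_left hpos).mp hB

end Summit.CriticalPhenomena.Ising3D.Control2D
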